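import Summits.QuantumFields.YangMills.Theses.BoundedSkewnessRunning
import Literature.MathematicalPhysics.QuantumFieldTheory.LatticeGaugeProofs

/-!
# Route `BoundedSkewnessRunning`, support item S1 `SchemeCumulantScaling` (stmt-QuantumFields-19898): the seven-term third cumulant of the
# smeared curvature along a scheme is `(c_k·√T_k)³` times the self-normalised one — multilinearity in the renormalisation constants

Width seat ym-line-sfw-p2-w2 g20 (cell `ym-idea-1`, free hands).  Pure algebra of the self-normalisation: no summit, no mass gap, no statement about
the running of the skewness is proved here.

* §1 ★ `kappa3_affine` — on a probability space, for bounded measurable `Y₁, Y₂, Y₃` and `Z_i = c·Y_i + e_i`, the seven-term third cumulant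
  `E[Z₁Z₂Z₃] − E[Z₁]E[Z₂Z₃] − E[Z₂]E[Z₁Z₃] − E[Z₃]E[Z₁Z₂] + 2E[Z₁]E[Z₂]E[Z₃]` equals `c³` times that of `(Y₁, Y₂, Y₃)` (shift invariance and
  3-homogeneity, by expanding the eight / four / two monomials and `ring`).
* §2 `smearedLatticeField_affine` — `Φ_{a,c,m}(φ) = c·Φ_{a,1,0}(φ) − c·m·a⁴Σ_x φ(ax)`: the smeared lattice field (tree `YangMillsOS.smearedLatticeField`)
  is affine in `(c, m)`; `abs_smearedLatticeField_le` — boundedness for a bounded observable.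
* §3 ★★ `schemeCumulantScaling_proof` — along `sch` the three curvature fields are `c_k·Y + e` and along the self-normalised scheme `cruxCanon`
  (`c'_k = 1/√T_k(u)`, `m'_k = ⟨F⟩_k`; same `a, L, β`, same torus and Wilson measure) they are `Y/√T_k + e'`, so both cumulants are multiples of
  the cumulant of `Y` and their ratio is `(c_k·√T_k)³` (`T_k > 0`).

References: K. Osterwalder, E. Seiler, Ann. Phys. **110** (1978) 440–471 (lattice Schwinger functions); I. Montvay, G. Münster, *Quantum Fields on a
Lattice* (1994) §1.5 (renormalised lattice fields).
-/

set_option autoImplicit false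

noncomputable section

open MeasureTheory

namespace Summit.QuantumFields.YangMills.Theorems.SchemeCumulantScalingProof

variable {Ω : Type*} [MeasurableSpace Ω]

/-- Bounded measurable real functions on a finite measure space are integrable. [folklore] -/
theorem integrable_of_abs_le (μ : Measure Ω) [IsFiniteMeasure μ] {Y : Ω → ℝ} (hm : Measurable Y) {B : ℝ}
    (hb : ∀ ω, |Y ω| ≤ B) : Integrable Y μ :=
  (integrable_const B).mono' hm.aestronglyMeasurable (ae_of_all _ fun ω => by simpa [Real.norm_eq_abs] using hb ω)

/-- ★ **THE THIRD CUMULANT IS SHIFT-INVARIANT AND 3-HOMOGENEOUS**: for bounded measurable `Y₁, Y₂, Y₃` on a probability space and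
`Z_i = c·Y_i + e_i`, the seven-term third cumulant of `(Z₁, Z₂, Z₃)` is `c³` times that of `(Y₁, Y₂, Y₃)`. [folklore] -/
theorem kappa3_affine (μ : Measure Ω) [IsProbabilityMeasure μ] {Y₁ Y₂ Y₃ Z₁ Z₂ Z₃ : Ω → ℝ}
    (h1 : Measurable Y₁) (h2 : Measurable Y₂) (h3 : Measurable Y₃) {B₁ B₂ B₃ : ℝ}
    (hb1 : ∀ ω, |Y₁ ω| ≤ B₁) (hb2 : ∀ ω, |Y₂ ω| ≤ B₂) (hb3 : ∀ ω, |Y₃ ω| ≤ B₃) (c e₁ e₂ e₃ : ℝ)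
    (hZ1 : ∀ ω, Z₁ ω = c * Y₁ ω + e₁) (hZ2 : ∀ ω, Z₂ ω = c * Y₂ ω + e₂) (hZ3 : ∀ ω, Z₃ ω = c * Y₃ ω + e₃) :
    (∫ ω, Z₁ ω * (Z₂ ω * Z₃ ω) ∂μ) - (∫ ω, Z₁ ω ∂μ) * (∫ ω, Z₂ ω * Z₃ ω ∂μ)
        - (∫ ω, Z₂ ω ∂μ) * (∫ ω, Z₁ ω * Z₃ ω ∂μ) - (∫ ω, Z₃ ω ∂μ) * (∫ ω, Z₁ ω * Z₂ ω ∂μ)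
        + 2 * ((∫ ω, Z₁ ω ∂μ) * (∫ ω, Z₂ ω ∂μ) * (∫ ω, Z₃ ω ∂μ)) =
      c ^ 3 * ((∫ ω, Y₁ ω * (Y₂ ω * Y₃ ω) ∂μ) - (∫ ω, Y₁ ω ∂μ) * (∫ ω, Y₂ ω * Y₃ ω ∂μ)
        - (∫ ω, Y₂ ω ∂μ) * (∫ ω, Y₁ ω * Y₃ ω ∂μ) - (∫ ω, Y₃ ω ∂μ) * (∫ ω, Y₁ ω * Y₂ ω ∂μ)
        + 2 * ((∫ ω, Y₁ ω ∂μ) * (∫ ω, Y₂ ω ∂μ) * (∫ ω, Y₃ ω ∂μ))) := by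
  -- integrability of all monomials (bounded measurable)
  have i1 : Integrable Y₁ μ := integrable_of_abs_le μ h1 hb1
  have i2 : Integrable Y₂ μ := integrable_of_abs_le μ h2 hb2
  have i3 : Integrable Y₃ μ := integrable_of_abs_le μ h3 hb3
  have i23 : Integrable (fun ω => Y₂ ω * Y₃ ω) μ := integrable_of_abs_le μ (h2.mul h3) (B := B₂ * B₃)
    fun ω => by rw [abs_mul]; exact mul_le_mul (hb2 ω) (hb3 ω) (abs_nonneg _) ((abs_nonneg _).trans (hb2 ω))
  have i13 : Integrable (fun ω => Y₁ ω * Y₃ ω) μ := integrable_of_abs_le μ (h1.mul h3) (B := B₁ * B₃)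
    fun ω => by rw [abs_mul]; exact mul_le_mul (hb1 ω) (hb3 ω) (abs_nonneg _) ((abs_nonneg _).trans (hb1 ω))
  have i12 : Integrable (fun ω => Y₁ ω * Y₂ ω) μ := integrable_of_abs_le μ (h1.mul h2) (B := B₁ * B₂)
    fun ω => by rw [abs_mul]; exact mul_le_mul (hb1 ω) (hb2 ω) (abs_nonneg _) ((abs_nonneg _).trans (hb1 ω))
  have i123 : Integrable (fun ω => Y₁ ω * (Y₂ ω * Y₃ ω)) μ :=
    integrable_of_abs_le μ (h1.mul (h2.mul h3)) (B := B₁ * (B₂ * B₃)) fun ω => by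
      rw [abs_mul, abs_mul]
      exact mul_le_mul (hb1 ω) (mul_le_mul (hb2 ω) (hb3 ω) (abs_nonneg _) ((abs_nonneg _).trans (hb2 ω)))
        (by positivity) ((abs_nonneg _).trans (hb1 ω))
  -- the three first moments
  have m1 : ∫ ω, Z₁ ω ∂μ = c * (∫ ω, Y₁ ω ∂μ) + e₁ := by
    simp_rw [hZ1]; rw [integral_add (i1.const_mul c) (integrable_const _), integral_const_mul, integral_const]; simp
  have m2 : ∫ ω, Z₂ ω ∂μ = c * (∫ ω, Y₂ ω ∂μ) + e₂ := by
    simp_rw [hZ2]; rw [integral_add (i2.const_mul c) (integrable_const _), integral_const_mul, integral_const]; simp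
  have m3 : ∫ ω, Z₃ ω ∂μ = c * (∫ ω, Y₃ ω ∂μ) + e₃ := by
    simp_rw [hZ3]; rw [integral_add (i3.const_mul c) (integrable_const _), integral_const_mul, integral_const]; simp
  -- the three second moments
  have pair : ∀ {U V : Ω → ℝ} (iU : Integrable U μ) (iV : Integrable V μ) (iUV : Integrable (fun ω => U ω * V ω) μ)
      (a b : ℝ), ∫ ω, (c * U ω + a) * (c * V ω + b) ∂μ =
        c ^ 2 * (∫ ω, U ω * V ω ∂μ) + c * b * (∫ ω, U ω ∂μ) + c * a * (∫ ω, V ω ∂μ) + a * b := by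
    intro U V iU iV iUV a b
    have he : (fun ω => (c * U ω + a) * (c * V ω + b)) =
        fun ω => c ^ 2 * (U ω * V ω) + c * b * U ω + c * a * V ω + a * b := funext fun ω => by ring
    have k1 : Integrable (fun ω => c ^ 2 * (U ω * V ω)) μ := iUV.const_mul _
    have k2 : Integrable (fun ω => c ^ 2 * (U ω * V ω) + c * b * U ω) μ := k1.add (iU.const_mul _)
    have k3 : Integrable (fun ω => c ^ 2 * (U ω * V ω) + c * b * U ω + c * a * V ω) μ := k2.add (iV.const_mul _)
    rw [he, integral_add k3 (integrable_const _), integral_add k2 (iV.const_mul _), integral_add k1 (iU.const_mul _),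
      integral_const_mul, integral_const_mul, integral_const_mul, integral_const]
    simp
  have m23 : ∫ ω, Z₂ ω * Z₃ ω ∂μ = c ^ 2 * (∫ ω, Y₂ ω * Y₃ ω ∂μ) + c * e₃ * (∫ ω, Y₂ ω ∂μ) + c * e₂ * (∫ ω, Y₃ ω ∂μ) + e₂ * e₃ := by
    simp_rw [hZ2, hZ3]; exact pair i2 i3 i23 e₂ e₃
  have m13 : ∫ ω, Z₁ ω * Z₃ ω ∂μ = c ^ 2 * (∫ ω, Y₁ ω * Y₃ ω ∂μ) + c * e₃ * (∫ ω, Y₁ ω ∂μ) + c * e₁ * (∫ ω, Y₃ ω ∂μ) + e₁ * e₃ := by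
    simp_rw [hZ1, hZ3]; exact pair i1 i3 i13 e₁ e₃
  have m12 : ∫ ω, Z₁ ω * Z₂ ω ∂μ = c ^ 2 * (∫ ω, Y₁ ω * Y₂ ω ∂μ) + c * e₂ * (∫ ω, Y₁ ω ∂μ) + c * e₁ * (∫ ω, Y₂ ω ∂μ) + e₁ * e₂ := by
    simp_rw [hZ1, hZ2]; exact pair i1 i2 i12 e₁ e₂
  -- the third moment
  have m123 : ∫ ω, Z₁ ω * (Z₂ ω * Z₃ ω) ∂μ =
      c ^ 3 * (∫ ω, Y₁ ω * (Y₂ ω * Y₃ ω) ∂μ) + c ^ 2 * e₃ * (∫ ω, Y₁ ω * Y₂ ω ∂μ) + c ^ 2 * e₂ * (∫ ω, Y₁ ω * Y₃ ω ∂μ)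
        + c ^ 2 * e₁ * (∫ ω, Y₂ ω * Y₃ ω ∂μ) + c * e₂ * e₃ * (∫ ω, Y₁ ω ∂μ) + c * e₁ * e₃ * (∫ ω, Y₂ ω ∂μ)
        + c * e₁ * e₂ * (∫ ω, Y₃ ω ∂μ) + e₁ * e₂ * e₃ := by
    simp_rw [hZ1, hZ2, hZ3]
    have he : (fun ω => (c * Y₁ ω + e₁) * ((c * Y₂ ω + e₂) * (c * Y₃ ω + e₃))) =
        fun ω => c ^ 3 * (Y₁ ω * (Y₂ ω * Y₃ ω)) + c ^ 2 * e₃ * (Y₁ ω * Y₂ ω) + c ^ 2 * e₂ * (Y₁ ω * Y₃ ω)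
          + c ^ 2 * e₁ * (Y₂ ω * Y₃ ω) + c * e₂ * e₃ * Y₁ ω + c * e₁ * e₃ * Y₂ ω + c * e₁ * e₂ * Y₃ ω + e₁ * e₂ * e₃ :=
      funext fun ω => by ring
    have j1 : Integrable (fun ω => c ^ 3 * (Y₁ ω * (Y₂ ω * Y₃ ω))) μ := i123.const_mul _
    have j2 : Integrable (fun ω => c ^ 3 * (Y₁ ω * (Y₂ ω * Y₃ ω)) + c ^ 2 * e₃ * (Y₁ ω * Y₂ ω)) μ :=
      j1.add (i12.const_mul _)
    have j3 : Integrable (fun ω => c ^ 3 * (Y₁ ω * (Y₂ ω * Y₃ ω)) + c ^ 2 * e₃ * (Y₁ ω * Y₂ ω)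
        + c ^ 2 * e₂ * (Y₁ ω * Y₃ ω)) μ := j2.add (i13.const_mul _)
    have j4 : Integrable (fun ω => c ^ 3 * (Y₁ ω * (Y₂ ω * Y₃ ω)) + c ^ 2 * e₃ * (Y₁ ω * Y₂ ω)
        + c ^ 2 * e₂ * (Y₁ ω * Y₃ ω) + c ^ 2 * e₁ * (Y₂ ω * Y₃ ω)) μ := j3.add (i23.const_mul _)
    have j5 : Integrable (fun ω => c ^ 3 * (Y₁ ω * (Y₂ ω * Y₃ ω)) + c ^ 2 * e₃ * (Y₁ ω * Y₂ ω)
        + c ^ 2 * e₂ * (Y₁ ω * Y₃ ω) + c ^ 2 * e₁ * (Y₂ ω * Y₃ ω) + c * e₂ * e₃ * Y₁ ω) μ := j4.add (i1.const_mul _)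
    have j6 : Integrable (fun ω => c ^ 3 * (Y₁ ω * (Y₂ ω * Y₃ ω)) + c ^ 2 * e₃ * (Y₁ ω * Y₂ ω)
        + c ^ 2 * e₂ * (Y₁ ω * Y₃ ω) + c ^ 2 * e₁ * (Y₂ ω * Y₃ ω) + c * e₂ * e₃ * Y₁ ω + c * e₁ * e₃ * Y₂ ω) μ :=
      j5.add (i2.const_mul _)
    have j7 : Integrable (fun ω => c ^ 3 * (Y₁ ω * (Y₂ ω * Y₃ ω)) + c ^ 2 * e₃ * (Y₁ ω * Y₂ ω)
        + c ^ 2 * e₂ * (Y₁ ω * Y₃ ω) + c ^ 2 * e₁ * (Y₂ ω * Y₃ ω) + c * e₂ * e₃ * Y₁ ω + c * e₁ * e₃ * Y₂ ω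
        + c * e₁ * e₂ * Y₃ ω) μ := j6.add (i3.const_mul _)
    rw [he, integral_add j7 (integrable_const _), integral_add j6 (i3.const_mul _), integral_add j5 (i2.const_mul _),
      integral_add j4 (i1.const_mul _), integral_add j3 (i23.const_mul _), integral_add j2 (i13.const_mul _),
      integral_add j1 (i12.const_mul _)]
    simp only [integral_const_mul, integral_const, probReal_univ, smul_eq_mul, one_mul]
  rw [m1, m2, m3, m23, m13, m12, m123]
  ring


/-! ## §2 The smeared field is affine in the renormalisation constants -/

section Smeared

open scoped SchwartzMap
open Literature.Probability.LatticeModels (box)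
open Literature.MathematicalPhysics.AQFT Literature.MathematicalPhysics.QuantumLattice
open Literature.MathematicalPhysics.QuantumFieldTheory

variable {G : Type} [MeasurableSpace G]

/-- `Φ_{a,c,m}(φ) = c·Φ_{a,1,0}(φ) − c·m·a⁴Σ_x φ(ax)`: the smeared lattice field is affine in `(c, m)`. [folklore] -/
theorem smearedLatticeField_affine (O : LGConfig 4 G → ℝ) (Λ : Finset (Literature.Probability.LatticeModels.Site 4))
    (a c m : ℝ) (φ : 𝓢(EuclideanSpace ℝ (Fin 4), ℝ)) (V : LGConfig 4 G) :
    smearedLatticeField O Λ a c m φ V =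
      c * smearedLatticeField O Λ a 1 0 φ V + -(c * m * (a ^ 4 * ∑ x ∈ Λ, φ (a • siteToE x))) := by
  unfold smearedLatticeField
  simp only [sub_zero, one_mul, mul_sub, Finset.sum_sub_distrib]
  rw [← Finset.sum_mul]
  ring

/-- A smeared field of a bounded observable is bounded (unit normalisation, no centring). [folklore] -/
theorem abs_smearedLatticeField_le {O : LGConfig 4 G → ℝ} {C : ℝ} (hO : ∀ U, |O U| ≤ C)
    (Λ : Finset (Literature.Probability.LatticeModels.Site 4)) (a : ℝ) (φ : 𝓢(EuclideanSpace ℝ (Fin 4), ℝ)) (V : LGConfig 4 G) :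
    |smearedLatticeField O Λ a 1 0 φ V| ≤ |a ^ 4| * ∑ x ∈ Λ, |φ (a • siteToE x)| * C := by
  unfold smearedLatticeField
  rw [one_mul, abs_mul]
  refine mul_le_mul_of_nonneg_left ((Finset.abs_sum_le_sum_abs _ _).trans (Finset.sum_le_sum fun x _ => ?_)) (abs_nonneg _)
  rw [sub_zero, abs_mul]
  exact mul_le_mul_of_nonneg_left (hO _) (abs_nonneg _)

end Smeared

/-! ## §3 The support item -/

open scoped SchwartzMap
open Literature.Probability.LatticeModels (box)
open Literature.MathematicalPhysics.AQFT Literature.MathematicalPhysics.QuantumLattice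
open Literature.MathematicalPhysics.QuantumFieldTheory
open Summit.QuantumFields.YangMills.Theorems.SelfNormalisedSkewness.Negative

/-- ★★ **`SchemeCumulantScaling` HOLDS** (support item stmt-QuantumFields-19898, S1 of route `BoundedSkewnessRunning`): the seven-term third
cumulant of the smeared curvature along `sch` equals `(c_k·√T_k)³·κ₃^canon_k` — both cumulants are `c³`-multiples of the cumulant of the
unit-normalised uncentred field (`kappa3_affine`: the smeared field is affine in `(c, m)`, cumulants of order three are shift-invariant and
3-homogeneous), with `c = sch.c` resp. `c = 1/√T_k`, and `(c·√T)³·(1/√T)³ = c³` for `T > 0`. [folklore] -/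
theorem schemeCumulantScaling_proof :
    Summit.QuantumFields.YangMills.Theses.BoundedSkewnessRunning.SchemeCumulantScaling := by
  unfold Summit.QuantumFields.YangMills.Theses.BoundedSkewnessRunning.SchemeCumulantScaling
  intro G _ _ _ _ _ _ r sch u f g h k hT
  simp only [cruxKappa3, latticeSchwinger, Fin.prod_univ_succ, Fin.prod_univ_zero, Matrix.cons_val_zero, Matrix.cons_val_succ,
    mul_one]
  haveI : IsProbabilityMeasure (wilsonMeasure (d := 4) (L := sch.side k) (G := G) r.ρ (sch.β k)) :=
    isProbabilityMeasure_wilsonMeasure (d := 4) (L := sch.side k) r.ρ r.continuous (sch.β k)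
  -- the unit-normalised uncentred fields are bounded and measurable
  obtain ⟨C, hC⟩ := r.curvature.bounded
  have hYm : ∀ φ : 𝓢(E4, ℝ), Measurable fun U : GaugeConfig 4 (sch.side k) G =>
      smearedLatticeField r.curvature.F (box 4 (sch.L k)) (sch.a k) 1 0 φ (torusLift (sch.side k) U) := by
    intro φ
    unfold smearedLatticeField
    refine (Finset.measurable_sum _ fun x _ => ?_).const_mul _
    exact ((r.curvature.measurable.comp ((configShift _).measurable.comp (measurable_torusLift _))).sub_const _).const_mul _
  have hYb : ∀ (φ : 𝓢(E4, ℝ)) (U : GaugeConfig 4 (sch.side k) G),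
      |smearedLatticeField r.curvature.F (box 4 (sch.L k)) (sch.a k) 1 0 φ (torusLift (sch.side k) U)| ≤
        |sch.a k ^ 4| * ∑ x ∈ box 4 (sch.L k), |φ (sch.a k • siteToE x)| * C :=
    fun φ U => abs_smearedLatticeField_le hC _ _ φ _
  -- both seven-term cumulants are `c³`-multiples of the unit-normalised one
  have key : ∀ c m : ℝ,
      (∫ U, smearedLatticeField r.curvature.F (box 4 (sch.L k)) (sch.a k) c m f (torusLift (sch.side k) U) *
            (smearedLatticeField r.curvature.F (box 4 (sch.L k)) (sch.a k) c m g (torusLift (sch.side k) U) *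
              smearedLatticeField r.curvature.F (box 4 (sch.L k)) (sch.a k) c m h (torusLift (sch.side k) U))
            ∂wilsonMeasure r.ρ (sch.β k)) -
          (∫ U, smearedLatticeField r.curvature.F (box 4 (sch.L k)) (sch.a k) c m f (torusLift (sch.side k) U)
              ∂wilsonMeasure r.ρ (sch.β k)) *
            (∫ U, smearedLatticeField r.curvature.F (box 4 (sch.L k)) (sch.a k) c m g (torusLift (sch.side k) U) *
              smearedLatticeField r.curvature.F (box 4 (sch.L k)) (sch.a k) c m h (torusLift (sch.side k) U)
              ∂wilsonMeasure r.ρ (sch.β k)) -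
          (∫ U, smearedLatticeField r.curvature.F (box 4 (sch.L k)) (sch.a k) c m g (torusLift (sch.side k) U)
              ∂wilsonMeasure r.ρ (sch.β k)) *
            (∫ U, smearedLatticeField r.curvature.F (box 4 (sch.L k)) (sch.a k) c m f (torusLift (sch.side k) U) *
              smearedLatticeField r.curvature.F (box 4 (sch.L k)) (sch.a k) c m h (torusLift (sch.side k) U)
              ∂wilsonMeasure r.ρ (sch.β k)) -
          (∫ U, smearedLatticeField r.curvature.F (box 4 (sch.L k)) (sch.a k) c m h (torusLift (sch.side k) U)
              ∂wilsonMeasure r.ρ (sch.β k)) *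
            (∫ U, smearedLatticeField r.curvature.F (box 4 (sch.L k)) (sch.a k) c m f (torusLift (sch.side k) U) *
              smearedLatticeField r.curvature.F (box 4 (sch.L k)) (sch.a k) c m g (torusLift (sch.side k) U)
              ∂wilsonMeasure r.ρ (sch.β k)) +
          2 * ((∫ U, smearedLatticeField r.curvature.F (box 4 (sch.L k)) (sch.a k) c m f (torusLift (sch.side k) U)
              ∂wilsonMeasure r.ρ (sch.β k)) *
            (∫ U, smearedLatticeField r.curvature.F (box 4 (sch.L k)) (sch.a k) c m g (torusLift (sch.side k) U)
              ∂wilsonMeasure r.ρ (sch.β k)) *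
            (∫ U, smearedLatticeField r.curvature.F (box 4 (sch.L k)) (sch.a k) c m h (torusLift (sch.side k) U)
              ∂wilsonMeasure r.ρ (sch.β k))) =
        c ^ 3 * ((∫ U, smearedLatticeField r.curvature.F (box 4 (sch.L k)) (sch.a k) 1 0 f (torusLift (sch.side k) U) *
            (smearedLatticeField r.curvature.F (box 4 (sch.L k)) (sch.a k) 1 0 g (torusLift (sch.side k) U) *
              smearedLatticeField r.curvature.F (box 4 (sch.L k)) (sch.a k) 1 0 h (torusLift (sch.side k) U))
            ∂wilsonMeasure r.ρ (sch.β k)) -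
          (∫ U, smearedLatticeField r.curvature.F (box 4 (sch.L k)) (sch.a k) 1 0 f (torusLift (sch.side k) U)
              ∂wilsonMeasure r.ρ (sch.β k)) *
            (∫ U, smearedLatticeField r.curvature.F (box 4 (sch.L k)) (sch.a k) 1 0 g (torusLift (sch.side k) U) *
              smearedLatticeField r.curvature.F (box 4 (sch.L k)) (sch.a k) 1 0 h (torusLift (sch.side k) U)
              ∂wilsonMeasure r.ρ (sch.β k)) -
          (∫ U, smearedLatticeField r.curvature.F (box 4 (sch.L k)) (sch.a k) 1 0 g (torusLift (sch.side k) U)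
              ∂wilsonMeasure r.ρ (sch.β k)) *
            (∫ U, smearedLatticeField r.curvature.F (box 4 (sch.L k)) (sch.a k) 1 0 f (torusLift (sch.side k) U) *
              smearedLatticeField r.curvature.F (box 4 (sch.L k)) (sch.a k) 1 0 h (torusLift (sch.side k) U)
              ∂wilsonMeasure r.ρ (sch.β k)) -
          (∫ U, smearedLatticeField r.curvature.F (box 4 (sch.L k)) (sch.a k) 1 0 h (torusLift (sch.side k) U)
              ∂wilsonMeasure r.ρ (sch.β k)) *
            (∫ U, smearedLatticeField r.curvature.F (box 4 (sch.L k)) (sch.a k) 1 0 f (torusLift (sch.side k) U) *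
              smearedLatticeField r.curvature.F (box 4 (sch.L k)) (sch.a k) 1 0 g (torusLift (sch.side k) U)
              ∂wilsonMeasure r.ρ (sch.β k)) +
          2 * ((∫ U, smearedLatticeField r.curvature.F (box 4 (sch.L k)) (sch.a k) 1 0 f (torusLift (sch.side k) U)
              ∂wilsonMeasure r.ρ (sch.β k)) *
            (∫ U, smearedLatticeField r.curvature.F (box 4 (sch.L k)) (sch.a k) 1 0 g (torusLift (sch.side k) U)
              ∂wilsonMeasure r.ρ (sch.β k)) *
            (∫ U, smearedLatticeField r.curvature.F (box 4 (sch.L k)) (sch.a k) 1 0 h (torusLift (sch.side k) U)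
              ∂wilsonMeasure r.ρ (sch.β k)))) :=
    fun c m => kappa3_affine (wilsonMeasure (d := 4) (L := sch.side k) (G := G) r.ρ (sch.β k)) (hYm f) (hYm g) (hYm h)
      (hYb f) (hYb g) (hYb h) c _ _ _ (fun U => smearedLatticeField_affine _ _ _ c m f _)
      (fun U => smearedLatticeField_affine _ _ _ c m g _) (fun U => smearedLatticeField_affine _ _ _ c m h _)
  -- the scalar identity `(c·√T)³·((1/√T)³·K) = c³·K`
  have hsT : Real.sqrt (cruxT r sch u k) ≠ 0 := (Real.sqrt_pos.mpr hT).ne'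
  have hscal : ∀ K : ℝ, (sch.c r.curvature k * Real.sqrt (cruxT r sch u k)) ^ 3 *
      ((Real.sqrt (cruxT r sch u k))⁻¹ ^ 3 * K) = sch.c r.curvature k ^ 3 * K := fun K => by
    field_simp
  rw [key (sch.c r.curvature k) (sch.m r.curvature k), ← hscal]
  have hR := key (Real.sqrt (cruxT r sch u k))⁻¹
    (∫ U, r.curvature.F (torusLift (sch.side k) U) ∂wilsonMeasure (d := 4) (L := sch.side k) (G := G) r.ρ (sch.β k))
  rw [← hR]
  rfl

end Summit.QuantumFields.YangMills.Theorems.SchemeCumulantScalingProof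

end
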